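import Mathlib
import HarnessLib
import Summits.HubbardSuperconductivity.HubbardSuperconductivity.Theorems.KLProgrammeKLRegimeThinPairFlowData
import Summits.HubbardSuperconductivity.HubbardSuperconductivity.Theorems.KLProgrammeKLRegimeEngineFlowPieceIncrementData
import Summits.HubbardSuperconductivity.HubbardSuperconductivity.Theorems.KLProgrammeKLRegimeThinPairRegimeScalars

/-!
# K3 VL child `KLRegimeVolumeLimitV17F2` (stmt-HubbardSuperconductivity-20440), located item #23 «W2-HALF-VL», COV/SEC shallow half, part 3 (FLOW DATA): the
# inputs of the decaying telescope step read off the history — the order-three size of `e_{K_m}`, the band increment of one flow piece in the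
# normalisation `G₀ = (Gfr₀+Gfr₁+Gfr₂+Gfr₃+1)·U` (Momentum side), `G₀ ≤ 1` in the regime, and a weight scale `n_w` between a rate `Λ_w` and `4Λ_w`

Cell `gate-hubbard-kl`, seat p3 (g16), lead of #23.  Small bookkeeping lemmas for the KL-level instantiation of `famStep_decay_le` / `covStep_decay_le`
(parts 2F/2C) along the flow frames `K_m = klFlowFrameU L M β U μ m`:

* `norm_iteratedFDeriv_three_frameLevel_klFlowFrameU_le` — `‖D³ e_{K_m}‖ ≤ 64 + Gfr₃·U²·(4^m/3)` from (I-F jets) below `m`;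
* `flowPiece_increment_jets_G₀` — `|e_{K_{m+1}} − e_{K_m}| ≤ G₀/(4^m)²`, `‖D·‖ ≤ G₀/4^m`, `‖D²·‖ ≤ G₀`, `‖D³·‖ ≤ G₀·4^m` for `G₀ := (Gfr₀+Gfr₁+Gfr₂+Gfr₃+1)·U`, `0 < U ≤ 1`;
* `sumGfr_mul_le_one_of_le_klEngU₀3` — `0 < G₀ ≤ 1` under the door `U ≤ klEngU₀3 P R c`;
* `exists_klScale_between` — for `0 < x ≤ klE0` a scale `n_w` with `x ≤ Λ_{n_w} < 4x`.

No definitions, no sorry.  Nothing asserts any stub, K3, VL or superconductivity. [cite: BenfattoGiulianiMastropietro2006, §3 (3.2)]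
-/

noncomputable section

namespace Summit.HubbardSuperconductivity.HubbardSuperconductivity.Theorems.TorusFourierL2

set_option linter.dupNamespace false -- summit = problem name (single-conjunct summit), D-0017

open Set Finset Literature.MathematicalPhysics.QuantumLattice Literature.MathematicalPhysics.QuantumLattice.BandSectorCounting
open Literature.MathematicalPhysics.QuantumLattice.FermiRG Literature.Probability.LatticeModels
open Summit.HubbardSuperconductivity.HubbardSuperconductivity.Theorems.DispersionFlow
open Summit.HubbardSuperconductivity.HubbardSuperconductivity.Theorems.KLRegimeSplit
open Summit.HubbardSuperconductivity.HubbardSuperconductivity.Theorems.KLProgrammeLegKernels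
open Summit.HubbardSuperconductivity.HubbardSuperconductivity.Theorems.PerturbedFermiCurve
open scoped Real

variable {L M : ℕ} [NeZero L] [NeZero M]

/-- **`‖D³ e_{K_m}‖ ≤ 64 + Gfr₃·U²·(4^m/3)`** from (I-F jets) at every `m′ < m` (the geometric sum of the pieces' third jets; `4³ = 64` is the bare band's).
[cite: BenfattoGiulianiMastropietro2006, §3 (3.2)] -/
theorem norm_iteratedFDeriv_three_frameLevel_klFlowFrameU_le {β U μ : ℝ} {R : RenConsts} (hR : ∀ j, 0 ≤ R.Gfr j) {m : ℕ}
    (hJ : ∀ m' < m, FlowPieceJetsAt L M β U μ R m') (p : Momentum) :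
    ‖iteratedFDeriv ℝ 3 (frameLevel μ (klFlowFrameU L M β U μ m)) p‖ ≤ 64 + R.Gfr 3 * U ^ 2 * ((4 : ℝ) ^ m / 3) := by
  have h0 := EngineV8.norm_iteratedFDeriv_frameLevel_klFlowFrameU_le (L := L) (M := M) (β := β) (U := U) (μ := μ) (i := 3) (by norm_num) (by norm_num) hJ p
  have e3 : uPow 3 U = U ^ 2 := by rw [show (3 : ℕ) = 2 + 1 by rfl, uPow_succ]
  have hterm : ∀ m' : ℕ, (4 : ℝ) ^ ((((3 : ℕ) : ℤ) - 2) * (m' : ℤ)) = (4 : ℝ) ^ m' := by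
    intro m'
    rw [show (((3 : ℕ) : ℤ) - 2) * (m' : ℤ) = ((m' : ℕ) : ℤ) by push_cast; ring, zpow_natCast]
  have hgeom : ∀ k : ℕ, ∑ m' ∈ range k, (4 : ℝ) ^ m' ≤ (4 : ℝ) ^ k / 3 := by
    intro k
    induction k with
    | zero => simp
    | succ k ih => rw [Finset.sum_range_succ, pow_succ]; linarith
  have hsum : ∑ m' ∈ range m, R.Gfr 3 * uPow 3 U * (4 : ℝ) ^ ((((3 : ℕ) : ℤ) - 2) * m') ≤ R.Gfr 3 * U ^ 2 * ((4 : ℝ) ^ m / 3) := by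
    calc ∑ m' ∈ range m, R.Gfr 3 * uPow 3 U * (4 : ℝ) ^ ((((3 : ℕ) : ℤ) - 2) * m')
        = R.Gfr 3 * U ^ 2 * ∑ m' ∈ range m, (4 : ℝ) ^ m' := by
          rw [Finset.mul_sum]; exact Finset.sum_congr rfl fun m' _ => by rw [e3, hterm]
      _ ≤ R.Gfr 3 * U ^ 2 * ((4 : ℝ) ^ m / 3) := mul_le_mul_of_nonneg_left (hgeom m) (by have := hR 3; positivity)
  have e64 : (4 : ℝ) ^ (3 : ℕ) = 64 := by norm_num
  rw [e64] at h0
  exact h0.trans (by linarith only [hsum])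

/-- **The band increment of one flow step in the normalisation `G₀ = (Gfr₀+Gfr₁+Gfr₂+Gfr₃+1)·U`** (Momentum side; `0 < U ≤ 1`): the four Euclidean jets of
`e_{K_{m+1}} − e_{K_m}` are `≤ G₀/(4^m)², G₀/4^m, G₀, G₀·4^m`. [cite: BenfattoGiulianiMastropietro2006, §3 (3.2)] -/
theorem flowPiece_increment_jets_G₀ {β U μ : ℝ} {R : RenConsts} (hR : ∀ j, 0 ≤ R.Gfr j) (hU : 0 < U) (hU1 : U ≤ 1) {m : ℕ}
    (hJ : FlowPieceJetsAt L M β U μ R m) :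
    (∀ p : Momentum, |frameLevel μ (klFlowFrameU L M β U μ (m + 1)) p - frameLevel μ (klFlowFrameU L M β U μ m) p| ≤
        (R.Gfr 0 + R.Gfr 1 + R.Gfr 2 + R.Gfr 3 + 1) * U / ((4 : ℝ) ^ m) ^ 2) ∧
    (∀ p : Momentum, ‖fderiv ℝ (fun q : Momentum => frameLevel μ (klFlowFrameU L M β U μ (m + 1)) q - frameLevel μ (klFlowFrameU L M β U μ m) q) p‖ ≤
        (R.Gfr 0 + R.Gfr 1 + R.Gfr 2 + R.Gfr 3 + 1) * U / (4 : ℝ) ^ m) ∧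
    (∀ p : Momentum, ‖iteratedFDeriv ℝ 2 (fun q : Momentum => frameLevel μ (klFlowFrameU L M β U μ (m + 1)) q - frameLevel μ (klFlowFrameU L M β U μ m) q) p‖ ≤
        (R.Gfr 0 + R.Gfr 1 + R.Gfr 2 + R.Gfr 3 + 1) * U) ∧
    (∀ p : Momentum, ‖iteratedFDeriv ℝ 3 (fun q : Momentum => frameLevel μ (klFlowFrameU L M β U μ (m + 1)) q - frameLevel μ (klFlowFrameU L M β U μ m) q) p‖ ≤
        (R.Gfr 0 + R.Gfr 1 + R.Gfr 2 + R.Gfr 3 + 1) * U * (4 : ℝ) ^ m) := by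
  obtain ⟨h0, h1, h2, h3⟩ := EngineV8.flowPiece_increment_data (L := L) (M := M) (μ := μ) hJ
  have hx0 : (0 : ℝ) < (4 : ℝ) ^ m := by positivity
  have hu0 : uPow 0 U = U := by simp [uPow, abs_of_pos hU]
  have hu : ∀ j, 1 ≤ j → uPow j U = U ^ 2 := fun j hj => by simp [uPow, show j ≠ 0 by omega]
  have hU2 : U ^ 2 ≤ U := by nlinarith only [hU, hU1]
  have hR0 := hR 0; have hR1 := hR 1; have hR2 := hR 2; have hR3 := hR 3
  set G : ℝ := (R.Gfr 0 + R.Gfr 1 + R.Gfr 2 + R.Gfr 3 + 1) * U with hGdef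
  have hG0 : R.Gfr 0 * U ≤ G := by rw [hGdef]; nlinarith only [hR1, hR2, hR3, hU.le]
  have hG1 : R.Gfr 1 * U ^ 2 ≤ G := by rw [hGdef]; nlinarith only [hR0, hR1, hR2, hR3, hU.le, hU2]
  have hG2 : R.Gfr 2 * U ^ 2 ≤ G := by rw [hGdef]; nlinarith only [hR0, hR1, hR2, hR3, hU.le, hU2]
  have hG3 : R.Gfr 3 * U ^ 2 ≤ G := by rw [hGdef]; nlinarith only [hR0, hR1, hR2, hR3, hU.le, hU2]
  have e0 : (4 : ℝ) ^ ((((0 : ℕ) : ℤ) - 2) * (m : ℤ)) = 1 / ((4 : ℝ) ^ m) ^ 2 := by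
    rw [show (((0 : ℕ) : ℤ) - 2) * (m : ℤ) = -((m * 2 : ℕ) : ℤ) by push_cast; ring, zpow_neg, zpow_natCast, pow_mul, one_div]
  have e1 : (4 : ℝ) ^ ((((1 : ℕ) : ℤ) - 2) * (m : ℤ)) = 1 / (4 : ℝ) ^ m := by
    rw [show (((1 : ℕ) : ℤ) - 2) * (m : ℤ) = -(m : ℤ) by push_cast; ring, zpow_neg, zpow_natCast, one_div]
  have e2 : (4 : ℝ) ^ ((((2 : ℕ) : ℤ) - 2) * (m : ℤ)) = 1 := by rw [show (((2 : ℕ) : ℤ) - 2) * (m : ℤ) = 0 by push_cast; ring, zpow_zero]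
  have e3 : (4 : ℝ) ^ ((((3 : ℕ) : ℤ) - 2) * (m : ℤ)) = (4 : ℝ) ^ m := by
    rw [show (((3 : ℕ) : ℤ) - 2) * (m : ℤ) = ((m : ℕ) : ℤ) by push_cast; ring, zpow_natCast]
  refine ⟨fun p => ?_, fun p => ?_, fun p => ?_, fun p => ?_⟩
  · refine (h0 p).trans ?_
    rw [hu0, e0, ← mul_div_assoc, mul_one]
    exact div_le_div_of_nonneg_right hG0 (by positivity)
  · refine (h1 p).trans ?_
    rw [hu 1 le_rfl, e1, ← mul_div_assoc, mul_one]
    exact div_le_div_of_nonneg_right hG1 hx0.le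
  · refine (h2 p).trans ?_
    rw [hu 2 (by norm_num), e2, mul_one]
    exact hG2
  · refine (h3 p).trans ?_
    rw [hu 3 (by norm_num), e3]
    exact mul_le_mul_of_nonneg_right hG3 hx0.le

/-- **`0 < G₀ ≤ 1`** for `G₀ = (Gfr₀+Gfr₁+Gfr₂+Gfr₃+1)·U` under the door `0 < U ≤ klEngU₀3 P R c` (`Gfr_j·U ≤ 2⁻¹²⁰`, `U ≤ 2⁻¹²⁰`). [folklore] -/
theorem sumGfr_mul_le_one_of_le_klEngU₀3 (P : SplitConsts) {R : RenConsts} (hR : ∀ j, 0 ≤ R.Gfr j) {c U : ℝ} (hU : 0 < U)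
    (hU₀ : U ≤ EngineV8.klEngU₀3 P R c) :
    0 < (R.Gfr 0 + R.Gfr 1 + R.Gfr 2 + R.Gfr 3 + 1) * U ∧ (R.Gfr 0 + R.Gfr 1 + R.Gfr 2 + R.Gfr 3 + 1) * U ≤ 1 := by
  have h0 := gfr_mul_le_of_le_klEngU₀3 P hU.le hU₀ (show 0 < 5 by norm_num)
  have h1 := gfr_mul_le_of_le_klEngU₀3 P hU.le hU₀ (show 1 < 5 by norm_num)
  have h2 := gfr_mul_le_of_le_klEngU₀3 P hU.le hU₀ (show 2 < 5 by norm_num)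
  have h3 := gfr_mul_le_of_le_klEngU₀3 P hU.le hU₀ (show 3 < 5 by norm_num)
  have hU1 : U ≤ 1 / (2 : ℝ) ^ 120 := by
    refine hU₀.trans ?_
    rw [EngineV8.klEngU₀3]
    refine one_div_le_one_div_of_le (by positivity) ?_
    have hP := EngineV8.one_le_klEngPsq P
    have hRs := EngineV8.one_le_klEngRsq R
    have h1' : (1 : ℝ) ≤ EngineV8.klEngPsq P ^ 2 := one_le_pow₀ hP
    have h2' : (1 : ℝ) ≤ EngineV8.klEngRsq R ^ 4 := one_le_pow₀ hRs
    have h3' : (1 : ℝ) ≤ c ^ 2 + 1 := by nlinarith [sq_nonneg c]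
    calc (2 : ℝ) ^ 120 = (2 : ℝ) ^ 120 * 1 * 1 * 1 := by ring
      _ ≤ (2 : ℝ) ^ 120 * EngineV8.klEngPsq P ^ 2 * EngineV8.klEngRsq R ^ 4 * (c ^ 2 + 1) := by gcongr
  have hsum : 1 ≤ R.Gfr 0 + R.Gfr 1 + R.Gfr 2 + R.Gfr 3 + 1 := by have := hR 0; have := hR 1; have := hR 2; have := hR 3; linarith
  refine ⟨mul_pos (by linarith) hU, ?_⟩
  have h120 : (1 : ℝ) / (2 : ℝ) ^ 120 ≤ 1 / 5 := by
    rw [div_le_div_iff₀ (by positivity) (by norm_num)]; norm_num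
  nlinarith only [h0, h1, h2, h3, hU1, h120]

omit [NeZero L] [NeZero M] in
/-- **A weight scale between a rate and four times it**: for `0 < x ≤ klE0` there is `n_w` with `x ≤ klScale klE0 n_w` and `klScale klE0 n_w < 4x`
(`klScale klE0 n = klE0/4ⁿ`; `exists_nat_pow_near` at base `4`). [folklore] -/
theorem exists_klScale_between {x : ℝ} (hx : 0 < x) (hxe : x ≤ klE0) : ∃ nw : ℕ, x ≤ klScale klE0 nw ∧ klScale klE0 nw < 4 * x := by
  have he : (0 : ℝ) < klE0 := by norm_num [klE0]
  have h1 : (1 : ℝ) ≤ klE0 / x := by rw [le_div_iff₀ hx, one_mul]; exact hxe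
  obtain ⟨n, hn, hn'⟩ := exists_nat_pow_near h1 (show (1 : ℝ) < 4 by norm_num)
  refine ⟨n, ?_, ?_⟩
  · rw [klScale, mul_comm]
    rw [le_div_iff₀ hx] at hn
    rw [inv_mul_eq_div, le_div_iff₀ (by positivity)]
    linarith
  · rw [klScale]
    rw [div_lt_iff₀ hx, pow_succ] at hn'
    rw [mul_comm, inv_mul_eq_div, div_lt_iff₀ (by positivity)]
    linarith

end Summit.HubbardSuperconductivity.HubbardSuperconductivity.Theorems.TorusFourierL2

end
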